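import Summits.Ventures.Crystal3D.Theorems.StickyWulffConstantGenericWallFloorWalkerFamilyLedger
import HarnessLib

/-!
# The WALKER-FAMILY LEDGER with FRAME-SEPARATED families (option (C), part (b′)): `#T₁ + #T₂ ≤ Σ_PAY (12 − deg)` without
# positional disjointness of the two families' ends
# (crux `GenericWallFloor`, stmt-Ventures-19480, line `WallLedgerG`; cf-p1 DECISION (xxxvii⁵): OffR := `FramesApart`)

HONEST FRAMING. Part of the venture `Summits/Ventures/Crystal3D` (cell `crystal3d-full`), helper `--supports` the crux
`GenericWallFloor` (stmt-Ventures-19480) of `route-Ventures-StickyWulffConstant`, registered line `WallLedgerG`, open stub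
`stub_twoSlabAdhesion`.  Rung credit only; F-C1 not moved; NOT the stub.

`walkerFamilies_card_le_payers` (`…WalkerFamilyLedger`) needs the two families' END BALLS positionally disjoint (`hdisj`), which
the positional F4 chain gets from disjoint reach sets.  The per-ball count it rests on, `card_contacts_add_endStates_le_twelve_sep`,
needs much less: the stack frames of family `i` lie in a set `Mᵢ` and no frame of `M₁` is Barlow-coaxial with a frame of `M₂`
(`hsep` — literally clause (iii) of `FramesApart`, `framesApart_sep`), plus distinct bottom entries.  Then two end states AT THE
SAME BALL, one from each family, are still different walker states with non-coaxial top frames, and `deg y + #ES₁ + #ES₂ ≤ 12`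
holds ball by ball.
* **`walkerFamilies_card_le_payers_sep`** — the two-family ledger with `hdisj` replaced by: `b₁ ≠ b₂`, the bottom-entry frame
  invariants `hM₁`, `hM₂` (every entry of a sound well-formed stack over `bᵢ` has its frame in `Mᵢ`, e.g.
  `frame_mem_chainFrames_of_stack`) and `hsep`.  Everything else (validity, strong certificates, fuel, injectivity on each
  family, ends in `PAY`) verbatim as in `walkerFamilies_card_le_payers`; inputs BY NAME `ExactOnly` (E1), `DoubleStarCoaxialAt`,
  `CapPairCoaxial` (`StarPairFar`).
WHAT THIS IS NOT: not the stub; no sealing, no flux count; F-C1 not moved.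
-/

noncomputable section

namespace Summit.Ventures.Crystal3D.Theorems

open Finset
open Literature.MathematicalPhysics.StatisticalMechanics (barlowStacking fccStacking IsHaggSeq)
open scoped InnerProductSpace

variable {X : Finset (EuclideanSpace ℝ (Fin 3))}

open scoped Classical in
/-- **The walker-family ledger (two families, frame-separated).**  See the module docstring.  `deg y` is
`#(X.filter (dist y · = 1))`; the end of `t` is `walkRun X zᵢ N (stᵢ t)`. -/
theorem walkerFamilies_card_le_payers_sep (hX : ∀ p ∈ X, ∀ q ∈ X, p ≠ q → 1 ≤ dist p q)
    {s₀ : EuclideanSpace ℝ (Fin 3)} (hs₀ : s₀ ∈ fccSlots)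
    (hcert : ExactOnly 0 (fccSlots.filter fun w => 0 < ⟪w, s₀⟫_ℝ))
    (hDS : ∀ F₁ F₂ : EuclideanSpace ℝ (Fin 3) ≃ₗᵢ[ℝ] EuclideanSpace ℝ (Fin 3), DoubleStarCoaxialAt F₁ F₂)
    (hCP : CapPairCoaxial)
    (M₁ M₂ : Set (EuclideanSpace ℝ (Fin 3) ≃ₗᵢ[ℝ] EuclideanSpace ℝ (Fin 3)))
    (hsep : ∀ F₁ ∈ M₁, ∀ F₂ ∈ M₂, ¬ ∃ (L : EuclideanSpace ℝ (Fin 3) ≃ₗᵢ[ℝ] EuclideanSpace ℝ (Fin 3))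
        (s₁ s₂ : EuclideanSpace ℝ (Fin 3)) (σ σ' : ℤ → ℤ), IsHaggSeq σ ∧ IsHaggSeq σ' ∧
        F₁ '' fccStacking 1 (Real.sqrt (2 / 3)) ⊆ (fun p => L p + s₁) '' barlowStacking 1 (Real.sqrt (2 / 3)) σ ∧
        F₂ '' fccStacking 1 (Real.sqrt (2 / 3)) ⊆ (fun p => L p + s₂) '' barlowStacking 1 (Real.sqrt (2 / 3)) σ')
    {z₁ z₂ : EuclideanSpace ℝ (Fin 3)} (hz₁ : ‖z₁‖ = 1) (hz₂ : ‖z₂‖ = 1) {H₁ H₂ : ℝ}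
    (hH₁ : ∀ q ∈ X, ⟪q, z₁⟫_ℝ ≤ H₁) (hH₂ : ∀ q ∈ X, ⟪q, z₂⟫_ℝ ≤ H₂)
    {ι₁ ι₂ : Type*} (T₁ : Finset ι₁) (T₂ : Finset ι₂)
    (st₁ : ι₁ → EuclideanSpace ℝ (Fin 3) × List WalkEntry) (st₂ : ι₂ → EuclideanSpace ℝ (Fin 3) × List WalkEntry)
    {b₁ b₂ : WalkEntry} (hbb : b₁ ≠ b₂) (N : ℕ)
    (hM₁ : ∀ stk : List WalkEntry, StackSound z₁ stk → StackWF z₁ stk → stk.getLast? = some b₁ → ∀ e ∈ stk, e.frame ∈ M₁)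
    (hM₂ : ∀ stk : List WalkEntry, StackSound z₂ stk → StackWF z₂ stk → stk.getLast? = some b₂ → ∀ e ∈ stk, e.frame ∈ M₂)
    (hst₁ : ∀ t ∈ T₁, WalkInv X z₁ (st₁ t) ∧ StackWF z₁ (st₁ t).2 ∧ (st₁ t).2.getLast? = some b₁ ∧
      (∃ e rest, (st₁ t).2 = e :: rest ∧ WalkCertified12 X (st₁ t).1 e) ∧ 8 * (H₁ - ⟪(st₁ t).1, z₁⟫_ℝ) < 3 * N)
    (hst₂ : ∀ t ∈ T₂, WalkInv X z₂ (st₂ t) ∧ StackWF z₂ (st₂ t).2 ∧ (st₂ t).2.getLast? = some b₂ ∧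
      (∃ e rest, (st₂ t).2 = e :: rest ∧ WalkCertified12 X (st₂ t).1 e) ∧ 8 * (H₂ - ⟪(st₂ t).1, z₂⟫_ℝ) < 3 * N)
    (hinj₁ : ∀ t ∈ T₁, ∀ t' ∈ T₁, walkRun X z₁ N (st₁ t) = walkRun X z₁ N (st₁ t') → t = t')
    (hinj₂ : ∀ t ∈ T₂, ∀ t' ∈ T₂, walkRun X z₂ N (st₂ t) = walkRun X z₂ N (st₂ t') → t = t')
    (PAY : Finset (EuclideanSpace ℝ (Fin 3)))
    (hPAY₁ : ∀ t ∈ T₁, (walkRun X z₁ N (st₁ t)).1 ∈ PAY) (hPAY₂ : ∀ t ∈ T₂, (walkRun X z₂ N (st₂ t)).1 ∈ PAY) :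
    (T₁.card : ℝ) + T₂.card ≤ ∑ y ∈ PAY, ((12 : ℝ) - ((X.filter fun q => dist y q = 1).card : ℝ)) := by
  set deg : EuclideanSpace ℝ (Fin 3) → ℕ := fun x => (X.filter fun q => dist x q = 1).card with hdeg
  have hdeg12 : ∀ x, deg x ≤ 12 := fun x => card_filter_dist_eq_one_le_twelve X hX x
  set f₁ : ι₁ → EuclideanSpace ℝ (Fin 3) × List WalkEntry := fun t => walkRun X z₁ N (st₁ t) with hf₁
  set f₂ : ι₂ → EuclideanSpace ℝ (Fin 3) × List WalkEntry := fun t => walkRun X z₂ N (st₂ t) with hf₂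
  -- the end data of each family (with the frame invariant of the end stack)
  have hend₁ : ∀ t ∈ T₁, deg (f₁ t).1 ≤ 11 ∧ WalkInv X z₁ (f₁ t) ∧ StackWF z₁ (f₁ t).2 ∧
      (f₁ t).2.getLast? = some b₁ ∧ (∃ e rest, (f₁ t).2 = e :: rest ∧ WalkCertified12 X (f₁ t).1 e) ∧
      ∀ e ∈ (f₁ t).2, e.frame ∈ M₁ := by
    intro t ht
    obtain ⟨hI, hW, hlast, hC, hN⟩ := hst₁ t ht
    obtain ⟨-, hydeg, -, -, -, -⟩ := stackWalk_end hX hs₀ hcert hz₁ hH₁ hI hN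
    have hvalid := walkRun_valid hX hs₀ hcert hz₁ N hI hW
    have hlastN : (f₁ t).2.getLast? = some b₁ := by
      rw [hf₁]; simp only; rw [walkRun_getLast? hX hs₀ hcert hz₁ N _ hI, hlast]
    exact ⟨hydeg, hvalid.1, hvalid.2, hlastN, walkRun_certified12 hX hs₀ hcert hz₁ hI hC N,
      hM₁ _ hvalid.1.2.1 hvalid.2 hlastN⟩
  have hend₂ : ∀ t ∈ T₂, deg (f₂ t).1 ≤ 11 ∧ WalkInv X z₂ (f₂ t) ∧ StackWF z₂ (f₂ t).2 ∧
      (f₂ t).2.getLast? = some b₂ ∧ (∃ e rest, (f₂ t).2 = e :: rest ∧ WalkCertified12 X (f₂ t).1 e) ∧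
      ∀ e ∈ (f₂ t).2, e.frame ∈ M₂ := by
    intro t ht
    obtain ⟨hI, hW, hlast, hC, hN⟩ := hst₂ t ht
    obtain ⟨-, hydeg, -, -, -, -⟩ := stackWalk_end hX hs₀ hcert hz₂ hH₂ hI hN
    have hvalid := walkRun_valid hX hs₀ hcert hz₂ N hI hW
    have hlastN : (f₂ t).2.getLast? = some b₂ := by
      rw [hf₂]; simp only; rw [walkRun_getLast? hX hs₀ hcert hz₂ N _ hI, hlast]
    exact ⟨hydeg, hvalid.1, hvalid.2, hlastN, walkRun_certified12 hX hs₀ hcert hz₂ hI hC N,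
      hM₂ _ hvalid.1.2.1 hvalid.2 hlastN⟩
  -- THE COUNT: per payer ball, `deg + #fibre₁ + #fibre₂ ≤ 12`
  have hpt : ∀ y ∈ PAY, deg y + (T₁.filter fun t => (f₁ t).1 = y).card + (T₂.filter fun t => (f₂ t).1 = y).card ≤ 12 := by
    intro y _
    set fib₁ := T₁.filter fun t => (f₁ t).1 = y with hfib₁
    set fib₂ := T₂.filter fun t => (f₂ t).1 = y with hfib₂
    by_cases hemp : fib₁ = ∅ ∧ fib₂ = ∅
    · rw [hemp.1, hemp.2, Finset.card_empty, Finset.card_empty]; have := hdeg12 y; omega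
    -- `y` is an end ball: at most eleven contacts
    have hdegy : deg y ≤ 11 := by
      rw [not_and_or] at hemp
      rcases hemp with hne | hne
      · obtain ⟨t, ht⟩ := Finset.nonempty_iff_ne_empty.2 hne; obtain ⟨htT, hty⟩ := Finset.mem_filter.1 ht
        have := (hend₁ t htT).1; rw [hty] at this; exact this
      · obtain ⟨t, ht⟩ := Finset.nonempty_iff_ne_empty.2 hne; obtain ⟨htT, hty⟩ := Finset.mem_filter.1 ht
        have := (hend₂ t htT).1; rw [hty] at this; exact this
    set ES₁ := fib₁.image f₁ with hES₁
    set ES₂ := fib₂.image f₂ with hES₂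
    have hc₁ : ES₁.card = fib₁.card := Finset.card_image_of_injOn fun t ht t' ht' hft =>
      hinj₁ t (Finset.mem_filter.1 ht).1 t' (Finset.mem_filter.1 ht').1 hft
    have hc₂ : ES₂.card = fib₂.card := Finset.card_image_of_injOn fun t ht t' ht' hft =>
      hinj₂ t (Finset.mem_filter.1 ht).1 t' (Finset.mem_filter.1 ht').1 hft
    have hES₁ok : ∀ s ∈ ES₁, s.1 = y ∧ WalkInv X z₁ s ∧ StackWF z₁ s.2 ∧ s.2.getLast? = some b₁ ∧
        (∃ e rest, s.2 = e :: rest ∧ WalkCertified12 X y e) ∧ ∀ e ∈ s.2, e.frame ∈ M₁ := by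
      intro s hs
      obtain ⟨t, ht, rfl⟩ := Finset.mem_image.1 hs; obtain ⟨htT, hty⟩ := Finset.mem_filter.1 ht
      obtain ⟨-, hI, hW, hlast, hC, hM⟩ := hend₁ t htT; rw [hty] at hC
      exact ⟨hty, hI, hW, hlast, hC, hM⟩
    have hES₂ok : ∀ s ∈ ES₂, s.1 = y ∧ WalkInv X z₂ s ∧ StackWF z₂ s.2 ∧ s.2.getLast? = some b₂ ∧
        (∃ e rest, s.2 = e :: rest ∧ WalkCertified12 X y e) ∧ ∀ e ∈ s.2, e.frame ∈ M₂ := by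
      intro s hs
      obtain ⟨t, ht, rfl⟩ := Finset.mem_image.1 hs; obtain ⟨htT, hty⟩ := Finset.mem_filter.1 ht
      obtain ⟨-, hI, hW, hlast, hC, hM⟩ := hend₂ t htT; rw [hty] at hC
      exact ⟨hty, hI, hW, hlast, hC, hM⟩
    have key := card_contacts_add_endStates_le_twelve_sep hX hDS hCP M₁ M₂ hsep hbb (z₁ := z₁) (z₂ := z₂) hdegy ES₁ ES₂
      hES₁ok hES₂ok
    rw [hc₁, hc₂] at key
    exact key
  -- summing over the payers
  have hsum₁ : T₁.card = ∑ y ∈ PAY, (T₁.filter fun t => (f₁ t).1 = y).card :=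
    Finset.card_eq_sum_card_fiberwise fun t ht => hPAY₁ t ht
  have hsum₂ : T₂.card = ∑ y ∈ PAY, (T₂.filter fun t => (f₂ t).1 = y).card :=
    Finset.card_eq_sum_card_fiberwise fun t ht => hPAY₂ t ht
  rw [hsum₁, hsum₂]; push_cast; rw [← Finset.sum_add_distrib]
  refine Finset.sum_le_sum fun y hy => ?_
  have := hpt y hy
  have h' : (deg y : ℝ) + ((T₁.filter fun t => (f₁ t).1 = y).card : ℝ) +
      ((T₂.filter fun t => (f₂ t).1 = y).card : ℝ) ≤ 12 := by exact_mod_cast this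
  simp only [hdeg] at h'; linarith

end Summit.Ventures.Crystal3D.Theorems

end
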